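import Literature.Probability.Percolation.BlockExplorationBasic
import Literature.Probability.Percolation.KozmaNitzanPreFKG
import HarnessLib

/-!
# `NoHeavyLowerTail` (stmt-CriticalPhenomena-4575) — the STEINER-BLOB decomposition of an observer, I:
# the blob contraction (combinatorics)

Lemma factory #6 (`prim-lf-6`, gen 4), 2026-08-19.  Infrastructure for conditioning on the observer's RELAY-FREE cluster
(memo `run/shared/lean/prim/prim-lf-6/CANDIDATES.md` §B4.1/§B4.4; lead memo LEAD-GEN5 §4b).  Vertex type `Fin n`, relays `A`,
observer `o ∉ A`, and a finite "blob" `V₀ ∋ o` disjoint from `A` (a candidate value of the vertex set of `o`'s open cluster in the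
graph with the relays deleted).  No definitions are introduced; the objects are written out as terms:

* the BLOB EVENT  `Blob(V₀) = {ω | (∀ u ∈ V₀, o ↔ u inside V₀) ∧ (∀ u ∈ V₀, ∀ x ∉ V₀ ∪ A, s(u,x) ∉ ω)}`
  (= "the relay-free cluster of `o` has vertex set exactly `V₀`", part II);
* the CONTRACTION  `Ψ(ω) = {e | (e ∈ ω ∧ e ∩ V₀ = ∅) ∨ (∃ a ∈ A, e = s(o,a) ∧ ∃ u ∈ V₀, s(u,a) ∈ ω)}`
  (pairs off the blob are kept, the blob's pairs towards each relay `a` are OR-merged into the single pair `s(o,a)`, every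
  other pair is closed — so under `Ψ(ω)` the observer `o` is ONE-LAYER).

This file: on `Blob(V₀)`, reachability between vertices of `(V₀)ᶜ ∪ {o}` is the same in `ω` and in `Ψ(ω)`
(`reachable_contract_iff`); reachability avoiding `V₀` in `ω` is reachability avoiding `o` in `Ψ(ω)` (`openConnIn_contract_iff`);
and `Ψ` is a block reading of `ω` for the vertex projection onto `o` (`contract_eq_readBlocks`).  Part II
(`…SteinerBlobMeasure`): `Ψ_* μ_w = μ_{w̃}` for the blob weights, independence of `Blob(V₀)` from `Ψ`, and the partition of the
space by the blob events; part III (`…PortSelection`): the port-selection lemma and the typed target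
`noHeavyLowerTail_of_portSelection`.  No sorries.
-/

namespace Summit.CriticalPhenomena.PercolationContinuityZ3.Theorems

open MeasureTheory Set Literature.Probability.LatticeModels Literature.Probability.Percolation
open Literature.Probability.Percolation.BlockExploration
open Literature.Probability.Percolation.KNPreFKG
open scoped Classical BigOperators

namespace SteinerBlob

variable {n : ℕ}

/-! ### Membership in the contracted configuration -/

/-- A pair off the blob is kept by the contraction. [this work] -/
theorem mem_contract_iff_of_disjoint {o : Fin n} {A V₀ : Finset (Fin n)} (ho : o ∈ V₀) {ω : BondConfig (Fin n)}
    {e : Sym2 (Fin n)} (he : ∀ v ∈ e, v ∉ V₀) :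
    e ∈ ({e : Sym2 (Fin n) | (e ∈ ω ∧ ∀ v ∈ e, v ∉ V₀) ∨
        ∃ a ∈ A, e = s(o, a) ∧ ∃ u ∈ V₀, s(u, a) ∈ ω} : Set (Sym2 (Fin n))) ↔ e ∈ ω := by
  simp only [mem_setOf_eq]
  constructor
  · rintro (⟨h, -⟩ | ⟨a, -, rfl, -⟩)
    · exact h
    · exact absurd ho (he o (Sym2.mem_mk_left o a))
  · exact fun h => Or.inl ⟨h, he⟩

/-- The merged pair `s(o,a)` of a relay `a` is open in the contraction iff some blob–`a` pair is open. [this work] -/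
theorem mk_mem_contract_iff {o : Fin n} {A V₀ : Finset (Fin n)} (ho : o ∈ V₀) (hVA : Disjoint V₀ A)
    {ω : BondConfig (Fin n)} {a : Fin n} (ha : a ∈ A) :
    s(o, a) ∈ ({e : Sym2 (Fin n) | (e ∈ ω ∧ ∀ v ∈ e, v ∉ V₀) ∨
        ∃ a ∈ A, e = s(o, a) ∧ ∃ u ∈ V₀, s(u, a) ∈ ω} : Set (Sym2 (Fin n))) ↔ ∃ u ∈ V₀, s(u, a) ∈ ω := by
  simp only [mem_setOf_eq]
  have hao : a ≠ o := fun h => Finset.disjoint_left.1 hVA ho (h ▸ ha)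
  constructor
  · rintro (⟨-, h⟩ | ⟨a', -, h, hu⟩)
    · exact absurd ho (h o (Sym2.mem_mk_left o a))
    · have : a' = a := by
        have := Sym2.eq_iff.1 h
        rcases this with ⟨-, h2⟩ | ⟨-, h2⟩
        · exact h2.symm
        · exact absurd h2 hao
      subst this
      exact hu
  · exact fun h => Or.inr ⟨a, ha, rfl, h⟩

/-- A pair of the contraction meeting the blob is a merged pair `s(o,a)`, `a ∈ A`. [this work] -/
theorem exists_eq_mk_of_mem_contract {o : Fin n} {A V₀ : Finset (Fin n)} {ω : BondConfig (Fin n)}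
    {e : Sym2 (Fin n)}
    (he : e ∈ ({e : Sym2 (Fin n) | (e ∈ ω ∧ ∀ v ∈ e, v ∉ V₀) ∨
        ∃ a ∈ A, e = s(o, a) ∧ ∃ u ∈ V₀, s(u, a) ∈ ω} : Set (Sym2 (Fin n))))
    (hmeet : ∃ v ∈ e, v ∈ V₀) :
    ∃ a ∈ A, e = s(o, a) ∧ ∃ u ∈ V₀, s(u, a) ∈ ω := by
  rcases he with ⟨-, h⟩ | h
  · obtain ⟨v, hv, hvV⟩ := hmeet
    exact absurd hvV (h v hv)
  · exact h

/-! ### Reachability through the blob -/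

/-- **Reachability is preserved by the contraction (on the blob event).**  If `ω ∈ Blob(V₀)` then for vertices
`x, y` each equal to `o` or outside `V₀`:  `x ↔ y` in `ω` iff `x ↔ y` in `Ψ(ω)`. [this work] -/
theorem reachable_contract_iff {o : Fin n} {A V₀ : Finset (Fin n)} (ho : o ∈ V₀) (hVA : Disjoint V₀ A)
    {ω : BondConfig (Fin n)}
    (hblob : ω ∈ ({ω : BondConfig (Fin n) | (∀ u ∈ V₀, ω ∈ openConnIn (↑V₀ : Set (Fin n)) o u) ∧
        ∀ u ∈ V₀, ∀ x, x ∉ V₀ → x ∉ A → s(u, x) ∉ ω} : Set (BondConfig (Fin n))))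
    {x y : Fin n} (hx : x = o ∨ x ∉ V₀) (hy : y = o ∨ y ∉ V₀) :
    (openGraph ω).Reachable x y ↔
      (openGraph ({e : Sym2 (Fin n) | (e ∈ ω ∧ ∀ v ∈ e, v ∉ V₀) ∨
        ∃ a ∈ A, e = s(o, a) ∧ ∃ u ∈ V₀, s(u, a) ∈ ω} : Set (Sym2 (Fin n)))).Reachable x y := by
  set η : BondConfig (Fin n) := {e : Sym2 (Fin n) | (e ∈ ω ∧ ∀ v ∈ e, v ∉ V₀) ∨
        ∃ a ∈ A, e = s(o, a) ∧ ∃ u ∈ V₀, s(u, a) ∈ ω} with hη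
  obtain ⟨hin, hout⟩ := hblob
  -- the projection `π v = o` on the blob, `v` off it
  let π : Fin n → Fin n := fun v => if v ∈ V₀ then o else v
  have hπ_of_mem : ∀ {v}, v ∈ V₀ → π v = o := fun hv => if_pos hv
  have hπ_of_not : ∀ {v}, v ∉ V₀ → π v = v := fun hv => if_neg hv
  have hπx : π x = x := by rcases hx with rfl | hx; exacts [hπ_of_mem ho, hπ_of_not hx]
  have hπy : π y = y := by rcases hy with rfl | hy; exacts [hπ_of_mem ho, hπ_of_not hy]
  constructor
  · -- (→): project an `ω`-walk
    rintro ⟨p⟩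
    suffices H : ∀ {u v : Fin n} (q : (openGraph ω).Walk u v), (openGraph η).Reachable (π u) (π v) by
      have := H p; rwa [hπx, hπy] at this
    intro u v q
    induction q with
    | nil => exact SimpleGraph.Reachable.refl _
    | @cons a b d hadj _ ih =>
      refine SimpleGraph.Reachable.trans ?_ ih
      obtain ⟨hab, hne⟩ := (openGraph_adj ω a b).1 hadj
      by_cases haV : a ∈ V₀ <;> by_cases hbV : b ∈ V₀
      · rw [hπ_of_mem haV, hπ_of_mem hbV]
      · -- `a ∈ V₀`, `b ∉ V₀`: then `b ∈ A` and `s(o,b) ∈ η`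
        have hbA : b ∈ A := by
          by_contra hbA; exact hout a haV b hbV hbA hab
        have hbo : b ≠ o := fun h => hbV (h ▸ ho)
        rw [hπ_of_mem haV, hπ_of_not hbV]
        have hmem : s(o, b) ∈ η := (mk_mem_contract_iff ho hVA hbA).2 ⟨a, haV, hab⟩
        exact ((openGraph_adj η o b).2 ⟨hmem, hbo.symm⟩).reachable
      · have haA : a ∈ A := by
          by_contra haA; exact hout b hbV a haV haA (Sym2.eq_swap ▸ hab)
        have hao : a ≠ o := fun h => haV (h ▸ ho)
        rw [hπ_of_not haV, hπ_of_mem hbV]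
        have hmem : s(o, a) ∈ η := (mk_mem_contract_iff ho hVA haA).2 ⟨b, hbV, Sym2.eq_swap ▸ hab⟩
        exact ((openGraph_adj η a o).2 ⟨Sym2.eq_swap ▸ hmem, hao⟩).reachable
      · rw [hπ_of_not haV, hπ_of_not hbV]
        have hmem : s(a, b) ∈ η := (mem_contract_iff_of_disjoint (A := A) ho (ω := ω) (fun v hv => by
          rcases Sym2.mem_iff.1 hv with rfl | rfl <;> assumption)).2 hab
        exact ((openGraph_adj η a b).2 ⟨hmem, hne⟩).reachable
  · -- (←): lift an `η`-walk; it never enters `V₀ ∖ {o}`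
    rintro ⟨p⟩
    suffices H : ∀ {u v : Fin n} (q : (openGraph η).Walk u v), (u = o ∨ u ∉ V₀) →
        (openGraph ω).Reachable u v from H p hx
    intro u v q
    induction q with
    | nil => exact fun _ => SimpleGraph.Reachable.refl _
    | @cons a b d hadj _ ih =>
      intro ha
      obtain ⟨hab, hne⟩ := (openGraph_adj η a b).1 hadj
      by_cases hmeet : ∃ v ∈ s(a, b), v ∈ V₀
      · -- a merged pair `s(o,a')`
        obtain ⟨a', ha'A, heq, u', hu'V, hu'a'⟩ := exists_eq_mk_of_mem_contract hab hmeet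
        have ha'V : a' ∉ V₀ := fun h => Finset.disjoint_left.1 hVA h ha'A
        have hoa' : (openGraph ω).Reachable o a' :=
          (reachable_of_openConnIn (hin u' hu'V)).trans
            ((openGraph_adj ω u' a').2 ⟨hu'a', fun h => ha'V (h ▸ hu'V)⟩).reachable
        -- `{a, b} = {o, a'}`
        rcases Sym2.eq_iff.1 heq with ⟨rfl, rfl⟩ | ⟨rfl, rfl⟩
        · exact hoa'.trans (ih (Or.inr ha'V))
        · exact hoa'.symm.trans (ih (Or.inl rfl))
      · push Not at hmeet
        have hmem : s(a, b) ∈ ω := (mem_contract_iff_of_disjoint (A := A) ho (ω := ω) hmeet).1 hab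
        have hbV : b ∉ V₀ := hmeet b (Sym2.mem_mk_right a b)
        exact ((openGraph_adj ω a b).2 ⟨hmem, hne⟩).reachable.trans (ih (Or.inr hbV))

/-- **Reachability avoiding the blob = reachability avoiding `o` after contraction** (no blob hypothesis needed):
for `x ∉ V₀`, `x ↔ y` in `ω` inside `(V₀)ᶜ` iff `x ↔ y` in `Ψ(ω)` inside `{o}ᶜ`. [this work] -/
theorem openConnIn_contract_iff {o : Fin n} {A V₀ : Finset (Fin n)} (ho : o ∈ V₀)
    {ω : BondConfig (Fin n)} {x y : Fin n} (hx : x ∉ V₀) :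
    ω ∈ openConnIn ((↑V₀ : Set (Fin n))ᶜ) x y ↔
      ({e : Sym2 (Fin n) | (e ∈ ω ∧ ∀ v ∈ e, v ∉ V₀) ∨
        ∃ a ∈ A, e = s(o, a) ∧ ∃ u ∈ V₀, s(u, a) ∈ ω} : Set (Sym2 (Fin n))) ∈
        openConnIn (({o} : Set (Fin n))ᶜ) x y := by
  set η : BondConfig (Fin n) := {e : Sym2 (Fin n) | (e ∈ ω ∧ ∀ v ∈ e, v ∉ V₀) ∨
        ∃ a ∈ A, e = s(o, a) ∧ ∃ u ∈ V₀, s(u, a) ∈ ω} with hη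
  have hsub : ((↑V₀ : Set (Fin n))ᶜ) ⊆ (({o} : Set (Fin n))ᶜ) := by
    intro v hv; rw [mem_compl_iff, mem_singleton_iff]; rintro rfl; exact hv (Finset.mem_coe.2 ho)
  constructor
  · intro h
    -- same pairs inside `(V₀)ᶜ`, then enlarge the ambient set
    have h' : η ∈ openConnIn ((↑V₀ : Set (Fin n))ᶜ) x y :=
      openConnIn_of_agree h fun a ha b hb hab =>
        (mem_contract_iff_of_disjoint (A := A) ho (ω := ω) (fun v hv => by
          rcases Sym2.mem_iff.1 hv with rfl | rfl
          · exact fun h => ha (Finset.mem_coe.2 h)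
          · exact fun h => hb (Finset.mem_coe.2 h))).2 hab
    obtain ⟨hx', hy', hr⟩ := h'
    exact ⟨hsub hx', hsub hy', hr.map (SimpleGraph.induceHomOfLE (G := openGraph η) hsub).toHom⟩
  · intro h
    rw [mem_openConnIn_iff_pathIn] at h ⊢
    obtain ⟨-, h⟩ := h
    refine ⟨fun h => hx (Finset.mem_coe.1 h), ?_⟩
    -- induct along the chain; every step is an `ω`-open pair off the blob
    have key : ∀ {c : Fin n}, Relation.ReflTransGen (fun a b => (openGraph η).Adj a b ∧ b ∈ (({o} : Set (Fin n))ᶜ)) x c →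
        c ∉ V₀ ∧ Relation.ReflTransGen (fun a b => (openGraph ω).Adj a b ∧ b ∈ ((↑V₀ : Set (Fin n))ᶜ)) x c := by
      intro c h
      induction h with
      | refl => exact ⟨hx, Relation.ReflTransGen.refl⟩
      | @tail b c _ hbc ih =>
        obtain ⟨hbV, ih'⟩ := ih
        obtain ⟨hadj, hco⟩ := hbc
        obtain ⟨hbc', hne⟩ := (openGraph_adj η b c).1 hadj
        have hdisj : ∀ v ∈ s(b, c), v ∉ V₀ := by
          intro v hv
          rcases Sym2.mem_iff.1 hv with rfl | rfl
          · exact hbV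
          · intro hcV
            obtain ⟨a, -, heq, -⟩ := exists_eq_mk_of_mem_contract hbc' ⟨v, Sym2.mem_mk_right b v, hcV⟩
            rcases Sym2.eq_iff.1 heq with ⟨rfl, -⟩ | ⟨-, rfl⟩
            · exact hbV ho
            · exact hco rfl
        have hmem : s(b, c) ∈ ω := (mem_contract_iff_of_disjoint (A := A) ho (ω := ω) hdisj).1 hbc'
        exact ⟨hdisj c (Sym2.mem_mk_right b c),
          ih'.tail ⟨(openGraph_adj ω b c).2 ⟨hmem, hne⟩, fun h => hdisj c (Sym2.mem_mk_right b c) (Finset.mem_coe.1 h)⟩⟩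
    exact (key h).2


/-! ### The contraction as a block reading: `Ψ_* μ_w = μ_{w̃}` -/

/-- `Sym2.map` of a map fixing both endpoints fixes the pair. [folklore] -/
theorem sym2_map_eq_self_of_forall {φ : Fin n → Fin n} {e : Sym2 (Fin n)} (h : ∀ v ∈ e, φ v = v) :
    Sym2.map φ e = e := by
  induction e using Sym2.ind with
  | h a b => rw [Sym2.map_mk, h a (Sym2.mem_mk_left a b), h b (Sym2.mem_mk_right a b)]

/-- **The contracted configuration is a block reading of `ω`** for the blocks of the vertex projection
`φ(v) = o` (`v ∈ V₀`), `φ(v) = v` otherwise: `Ψ(ω) = {j | ∃ e ∈ ω admissible, Sym2.map φ e = j}`, admissible meaning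
"off the blob, or a blob–relay pair". [this work] -/
theorem contract_eq_readBlocks {o : Fin n} {A V₀ : Finset (Fin n)} (hVA : Disjoint V₀ A)
    (ω : BondConfig (Fin n)) :
    ({e : Sym2 (Fin n) | (e ∈ ω ∧ ∀ v ∈ e, v ∉ V₀) ∨
        ∃ a ∈ A, e = s(o, a) ∧ ∃ u ∈ V₀, s(u, a) ∈ ω} : Set (Sym2 (Fin n))) =
      {j | ∃ e, e ∈ ω ∧ ((∀ v ∈ e, v ∉ V₀) ∨ ∃ a ∈ A, ∃ u ∈ V₀, e = s(u, a)) ∧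
        Sym2.map (fun v : Fin n => if v ∈ V₀ then o else v) e = j} := by
  ext j
  simp only [mem_setOf_eq]
  constructor
  · rintro (⟨hj, hdis⟩ | ⟨a, ha, rfl, u, hu, hua⟩)
    · exact ⟨j, hj, Or.inl hdis, sym2_map_eq_self_of_forall fun v hv => if_neg (hdis v hv)⟩
    · have haV : a ∉ V₀ := fun h => Finset.disjoint_left.1 hVA h ha
      exact ⟨s(u, a), hua, Or.inr ⟨a, ha, u, hu, rfl⟩, by rw [Sym2.map_mk, if_pos hu, if_neg haV]⟩
  · rintro ⟨e, he, hadm, rfl⟩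
    rcases hadm with hdis | ⟨a, ha, u, hu, rfl⟩
    · left
      rw [sym2_map_eq_self_of_forall fun v hv => if_neg (hdis v hv)]
      exact ⟨he, hdis⟩
    · right
      have haV : a ∉ V₀ := fun h => Finset.disjoint_left.1 hVA h ha
      refine ⟨a, ha, by rw [Sym2.map_mk, if_pos hu, if_neg haV], u, hu, he⟩

end SteinerBlob

end Summit.CriticalPhenomena.PercolationContinuityZ3.Theorems
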